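import Mathlib.Analysis.SpecialFunctions.Pow.Real
import HarnessLib

/-!
# HEX-SHARP (W-SPEC §6 (3)), arithmetic core: the EXPLICIT `(d,a,b)`-form depth inequality from a floor-free
# criterion `(j+1)·C + 1 < (k/l)·(j²−1)` — generic base, generic label, top label, uniform-in-`l` form, `k₂` table

Pure real arithmetic (classical; nothing disputed, nothing about elliptic curves or IUT objects) for the abc-iut
cell's rescue sub-cell R-W, lane P− task «HEX-SHARP» (HOME/plan/W/WINDOW-SPEC.md v0.3 §6 (3): "A `Hex.core_ineq`-style
lemma with constant 8.3 replaces the degree-form one"). Written by seat abc-iut-S-d1 (gen 8) as HEX-SHARP prover #2;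
the engine/assembly (§6 (1)/(2): the per-place bound `d + a + b ≤ C` at the place over `7` of the Legendre datum
`λ_k`, and the instantiation of `Summit.ABC.IUTFork.Conditional.not_hSH_v6K_of_exists_deep` / its M twin) is
abc-iut-w5-d163's and CONSUMES the theorems below BY NAME.

The premise `hex` of `not_hSH_v6K_of_exists_deep` (file `AbcOfSGenuineKChosenDepth`) at a prime `p`, a label
`j = i + 1` and a place `x₀ | p` is the real inequality

  `p ^ (((i : ℝ) + 2)·S + 1) · τ ^ ((i+1)² − 1) < 1`,   `S := d_{x₀} + a + b`,  `τ := ‖t_{q,x₀}‖`,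

and on the HEX family (`λ_k = 1/2 + 2/7^k`, `p = 7`) one has `τ ≤ 7^{−k/l}`. This file proves, for a REAL base
`1 < p`, ANY real `S ≤ C` and ANY `0 ≤ τ ≤ p^{−k/l}`:

* `Hex.rpow_mul_pow_lt_one` — `p^A · τ^B < 1` as soon as `A < (k/l)·B` (the one analytic step);
* `Hex.core_ineq_dab_label` — at ANY label `j = i+1 ≥ 2`: `l·((i+2)·C + 1) < k·(i·(i+2))` suffices (floor-free in
  `k`, so a FAMILY row «refuted ∀ k ≥ k₀» is honest, WINDOW-SPEC §2 last paragraph);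
* `Hex.core_ineq_dab` — at the TOP label `j = (l−1)/2` of an odd `l ≥ 5`, in the VERBATIM exponent/power shape of
  `Hex.core_ineq` (p442144) and of the `hex` binder (`i := (l−1)/2 − 1`):
  `4·l·((l+1)/2·C + 1) < k·(l−3)·(l+1)` suffices;
* `Hex.core_ineq_dab_of_le_of_lt` — UNIFORM in `l`: for every odd `l ≥ 11` and `0 ≤ C`, `(11/4)·C + 11/24 < k`
  suffices (`l/(l−3) ≤ 11/8` and `4l/((l−3)(l+1)) ≤ 11/24`, both tight at `l = 11`);
* the `k₂` TABLE at the spec's constant `C = 83/10` (§6 (1)–(2): `d < 1`, `a ≤ 1/5 + 1/e`, `b ≤ 7` for `l ≤ 17`):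
  `k ≥ 24` uniformly in odd `l ≥ 11`; per `l`: `k₂(11) = 24`, `k₂(13) = 22`, `k₂(17) = 21`, `k₂(19) = k₂(23) = 20`;
  and at `C = 93/10` (`b ≤ 8`, `l ≤ 125`): `k ≥ 27` uniformly.

HONEST SCOPE: these are implications between real inequalities; they refute nothing by themselves and say nothing about
which `C` the genuine data deliver (that is the engine's theorem). No side is taken on [IUTchIII] Cor. 3.12 or on any
author; «refuted as typed» ≠ «refuted in print»; nothing here asserts abc proved or refuted.
-/

noncomputable section

namespace Summit.ABC.IUTFork.Conditional.Hex

/-! ## 1. The analytic step -/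

/-- **The one analytic step.** For a real base `1 < p`, `0 ≤ τ ≤ p^{−κ}` and a natural power `B`: if `A < κ·B` then
`p^A · τ^B < 1` (`p^A·τ^B ≤ p^A·p^{−κB} = p^{A−κB} < p^0 = 1`). [folklore] -/
theorem rpow_mul_pow_lt_one {p κ A τ : ℝ} {B : ℕ} (hp : 1 < p) (hτ0 : 0 ≤ τ) (hτ : τ ≤ p ^ (-κ))
    (hA : A < κ * B) : p ^ A * τ ^ B < 1 := by
  have hp0 : 0 < p := by linarith
  have hpow : τ ^ B ≤ (p ^ (-κ)) ^ B := pow_le_pow_left₀ hτ0 hτ B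
  have hA0 : 0 < p ^ A := Real.rpow_pos_of_pos hp0 A
  calc p ^ A * τ ^ B ≤ p ^ A * (p ^ (-κ)) ^ B := mul_le_mul_of_nonneg_left hpow hA0.le
    _ = p ^ (A - κ * B) := by
        rw [← Real.rpow_natCast, ← Real.rpow_mul hp0.le, ← Real.rpow_add hp0]
        congr 1
        ring
    _ < p ^ (0 : ℝ) := Real.rpow_lt_rpow_of_exponent_lt hp (by linarith)
    _ = 1 := Real.rpow_zero p

/-! ## 2. Any label -/

/-- **`(d,a,b)`-form depth inequality at ANY label, floor-free criterion.** For a real base `1 < p`, naturals `k, l`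
with `0 < l`, a label `j = i + 1`, reals `S ≤ C` and `0 ≤ τ ≤ p^{−k/l}`: if `l·((i+2)·C + 1) < k·(i·(i+2))` (i.e.
`(j+1)·C + 1 < (k/l)·(j²−1)`), then `p^{((i+2)·S + 1)} · τ^{(i+1)²−1} < 1`. [folklore] -/
theorem core_ineq_dab_label {p C S τ : ℝ} {k l i : ℕ} (hp : 1 < p) (hl : 0 < l)
    (hk : (l : ℝ) * ((((i : ℕ) : ℝ) + 2) * C + 1) < (k : ℝ) * ((i : ℝ) * ((i : ℝ) + 2)))
    (hS : S ≤ C) (hτ0 : 0 ≤ τ) (hτ : τ ≤ p ^ (-((k : ℝ) / l))) :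
    p ^ ((((i : ℕ) : ℝ) + 2) * S + 1) * τ ^ ((i + 1) ^ 2 - 1) < 1 := by
  have hlR : (0 : ℝ) < l := by exact_mod_cast hl
  have hB : ((i + 1) ^ 2 - 1 : ℕ) = i * (i + 2) := by
    have : 1 ≤ (i + 1) ^ 2 := Nat.one_le_pow _ _ (by omega)
    zify [this]
    ring
  rw [hB]
  refine rpow_mul_pow_lt_one hp hτ0 hτ ?_
  -- `(i+2)·S + 1 ≤ (i+2)·C + 1 < (k/l)·(i(i+2))`
  have hi2 : (0 : ℝ) ≤ (i : ℝ) + 2 := by positivity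
  have h1 : (((i : ℕ) : ℝ) + 2) * S + 1 ≤ ((i : ℝ) + 2) * C + 1 := by
    nlinarith [mul_le_mul_of_nonneg_left hS hi2]
  have h2 : ((i : ℝ) + 2) * C + 1 < (k : ℝ) / l * ((i * (i + 2) : ℕ) : ℝ) := by
    push_cast
    rw [div_mul_eq_mul_div, lt_div_iff₀ hlR]
    linarith
  linarith

/-! ## 3. The top label `j = (l−1)/2` (the shape of `Hex.core_ineq` and of the `hex` binder) -/

/-- Cast bookkeeping at the top label: for odd `l ≥ 5` and `j := (l−1)/2`, `((j − 1 : ℕ) : ℝ) + 2 = j + 1`,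
`(j² − 1 : ℕ) = (j−1)(j+1)` and `(j : ℝ) = (l−1)/2`. [folklore] -/
theorem topLabel_casts {l : ℕ} (h5 : 5 ≤ l) (hodd : l % 2 = 1) :
    ((((l - 1) / 2 - 1 : ℕ) : ℝ) + 2 = (((l - 1) / 2 : ℕ) : ℝ) + 1) ∧
      ((((l - 1) / 2) ^ 2 - 1 : ℕ) = ((l - 1) / 2 - 1) * ((l - 1) / 2 + 1)) ∧
      ((((l - 1) / 2 : ℕ) : ℝ) = ((l : ℝ) - 1) / 2) := by
  set j : ℕ := (l - 1) / 2 with hj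
  have h2j : 2 * j = l - 1 := by omega
  have hj2 : 2 ≤ j := by omega
  refine ⟨?_, ?_, ?_⟩
  · rw [Nat.cast_sub (show 1 ≤ j by omega)]
    push_cast
    ring
  · have : 1 ≤ j ^ 2 := Nat.one_le_pow _ _ (by omega)
    zify [this, show 1 ≤ j by omega]
    ring
  · have : ((2 * j : ℕ) : ℝ) = ((l - 1 : ℕ) : ℝ) := by exact_mod_cast h2j
    push_cast [Nat.cast_sub (show 1 ≤ l by omega)] at this
    linarith

/-- **`(d,a,b)`-form depth inequality at the TOP label, floor-free criterion** (HEX-SHARP, W-SPEC §6 (3)). For a real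
base `1 < p`, an odd `l ≥ 5`, a natural `k`, reals `S ≤ C` (`S` = the packet's `d + a + b`) and `0 ≤ τ ≤ p^{−k/l}`:
if `4·l·((l+1)/2·C + 1) < k·(l−3)·(l+1)` — i.e. `(j+1)·C + 1 < (k/l)·(j²−1)` with `j = (l−1)/2`,
`j² − 1 = (l−3)(l+1)/4` — then
`p ^ ((((l−1)/2 − 1 : ℕ) + 2)·S + 1) · τ ^ (((l−1)/2)² − 1) < 1`
(exponent and power in the verbatim shape of `Hex.core_ineq` and of the `hex` binder of
`not_hSH_v6K_of_exists_deep` at `i := (l−1)/2 − 1`). [folklore] -/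
theorem core_ineq_dab {p C S τ : ℝ} {k l : ℕ} (hp : 1 < p) (h5 : 5 ≤ l) (hodd : l % 2 = 1)
    (hk : 4 * (l : ℝ) * (((l : ℝ) + 1) / 2 * C + 1) < (k : ℝ) * (((l : ℝ) - 3) * ((l : ℝ) + 1)))
    (hS : S ≤ C) (hτ0 : 0 ≤ τ) (hτ : τ ≤ p ^ (-((k : ℝ) / l))) :
    p ^ (((((l - 1) / 2 - 1 : ℕ) : ℝ) + 2) * S + 1) * τ ^ (((l - 1) / 2) ^ 2 - 1) < 1 := by
  obtain ⟨_, _, hjR⟩ := topLabel_casts h5 hodd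
  set j : ℕ := (l - 1) / 2 with hj
  have hj2 : 2 ≤ j := by omega
  -- rewrite the power `j² − 1` as `(i+1)² − 1` with `i = j − 1`
  have hpow : j ^ 2 - 1 = (j - 1 + 1) ^ 2 - 1 := by
    rw [Nat.sub_add_cancel (show 1 ≤ j by omega)]
  rw [hpow]
  refine core_ineq_dab_label hp (by omega) ?_ hS hτ0 hτ
  -- the criterion at `i = j − 1`: `l·((j+1)·C + 1) < k·((j−1)(j+1))`, from `hk` and `j = (l−1)/2`
  have hi : (((j - 1 : ℕ) : ℝ)) = (j : ℝ) - 1 := by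
    rw [Nat.cast_sub (show 1 ≤ j by omega), Nat.cast_one]
  rw [hi]
  have e1 : ((j : ℝ) - 1 + 2) * C + 1 = ((l : ℝ) + 1) / 2 * C + 1 := by rw [hjR]; ring
  have e2 : ((j : ℝ) - 1) * ((j : ℝ) - 1 + 2) = ((l : ℝ) - 3) * ((l : ℝ) + 1) / 4 := by rw [hjR]; ring
  rw [e1, e2]
  nlinarith

/-- The same statement with the label given as a natural `i` with `i + 1 = (l−1)/2` (the consumer's `i : Fin l⋆` is
such an `i`). [folklore] -/
theorem core_ineq_dab' {p C S τ : ℝ} {k l i : ℕ} (hp : 1 < p) (h5 : 5 ≤ l) (hodd : l % 2 = 1)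
    (hi : i + 1 = (l - 1) / 2)
    (hk : 4 * (l : ℝ) * (((l : ℝ) + 1) / 2 * C + 1) < (k : ℝ) * (((l : ℝ) - 3) * ((l : ℝ) + 1)))
    (hS : S ≤ C) (hτ0 : 0 ≤ τ) (hτ : τ ≤ p ^ (-((k : ℝ) / l))) :
    p ^ ((((i : ℕ) : ℝ) + 2) * S + 1) * τ ^ ((i + 1) ^ 2 - 1) < 1 := by
  have h1 : (l - 1) / 2 - 1 = i := by omega
  have h := core_ineq_dab (C := C) (S := S) (τ := τ) hp h5 hodd hk hS hτ0 hτ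
  rw [h1, ← hi] at h
  exact h

/-! ## 4. Uniform in `l ≥ 11` -/

/-- **The top-label criterion, uniformly in `l`.** For EVERY natural `l ≥ 11`, real `0 ≤ C` and natural `k` with
`(11/4)·C + 11/24 < k`: `4·l·((l+1)/2·C + 1) < k·(l−3)·(l+1)` (since `2l(l+1) ≤ (11/4)(l−3)(l+1)` iff `l ≥ 11`, and
`4l ≤ (11/24)(l−3)(l+1)` iff `11l² − 118l − 33 ≥ 0`, true from `l = 11` on, with equality there). [folklore] -/
theorem criterion_of_le_of_lt {C : ℝ} {k l : ℕ} (h11 : 11 ≤ l) (hC : 0 ≤ C)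
    (hk : (11 : ℝ) / 4 * C + 11 / 24 < k) :
    4 * (l : ℝ) * (((l : ℝ) + 1) / 2 * C + 1) < (k : ℝ) * (((l : ℝ) - 3) * ((l : ℝ) + 1)) := by
  have hl : (11 : ℝ) ≤ l := by exact_mod_cast h11
  have hprod : (0 : ℝ) < ((l : ℝ) - 3) * ((l : ℝ) + 1) := by nlinarith
  -- `2·l·(l+1)·C ≤ (11/4)·C·(l−3)(l+1)` and `4·l ≤ (11/24)·(l−3)(l+1)`
  have hA : 2 * (l : ℝ) * ((l : ℝ) + 1) * C ≤ (11 : ℝ) / 4 * C * (((l : ℝ) - 3) * ((l : ℝ) + 1)) := by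
    have : 2 * (l : ℝ) * ((l : ℝ) + 1) ≤ (11 : ℝ) / 4 * (((l : ℝ) - 3) * ((l : ℝ) + 1)) := by nlinarith
    nlinarith
  have hB : 4 * (l : ℝ) ≤ (11 : ℝ) / 24 * (((l : ℝ) - 3) * ((l : ℝ) + 1)) := by nlinarith
  have hk' : ((11 : ℝ) / 4 * C + 11 / 24) * (((l : ℝ) - 3) * ((l : ℝ) + 1)) <
      (k : ℝ) * (((l : ℝ) - 3) * ((l : ℝ) + 1)) := mul_lt_mul_of_pos_right hk hprod
  calc 4 * (l : ℝ) * (((l : ℝ) + 1) / 2 * C + 1) = 2 * (l : ℝ) * ((l : ℝ) + 1) * C + 4 * l := by ring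
    _ ≤ ((11 : ℝ) / 4 * C + 11 / 24) * (((l : ℝ) - 3) * ((l : ℝ) + 1)) := by nlinarith
    _ < (k : ℝ) * (((l : ℝ) - 3) * ((l : ℝ) + 1)) := hk'

/-- **HEX-SHARP arithmetic core, UNIFORM in `l`.** For a real base `1 < p`, an odd `l ≥ 11`, reals `0 ≤ C`, `S ≤ C`,
`0 ≤ τ ≤ p^{−k/l}` and a natural `k` with `(11/4)·C + 11/24 < k`:
`p ^ ((((l−1)/2 − 1 : ℕ) + 2)·S + 1) · τ ^ (((l−1)/2)² − 1) < 1`. [folklore] -/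
theorem core_ineq_dab_of_le_of_lt {p C S τ : ℝ} {k l : ℕ} (hp : 1 < p) (h11 : 11 ≤ l) (hodd : l % 2 = 1)
    (hC : 0 ≤ C) (hk : (11 : ℝ) / 4 * C + 11 / 24 < k)
    (hS : S ≤ C) (hτ0 : 0 ≤ τ) (hτ : τ ≤ p ^ (-((k : ℝ) / l))) :
    p ^ (((((l - 1) / 2 - 1 : ℕ) : ℝ) + 2) * S + 1) * τ ^ (((l - 1) / 2) ^ 2 - 1) < 1 :=
  core_ineq_dab hp (by omega) hodd (criterion_of_le_of_lt h11 hC hk) hS hτ0 hτ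

/-! ## 5. The `k₂` table at the spec's constants -/

/-- `C ≤ 83/10` (W-SPEC §6 (2)–(3): `d < 1`, `a ≤ 0.3`, `b ≤ 7` for `l ≤ 17`): `k ≥ 24` satisfies the uniform criterion
(`(11/4)·8.3 + 11/24 = 23.283… < 24`). [folklore] -/
theorem criterion_of_le_83_10 {C : ℝ} {k l : ℕ} (h11 : 11 ≤ l) (hC0 : 0 ≤ C) (hC : C ≤ 83 / 10) (hk : 24 ≤ k) :
    4 * (l : ℝ) * (((l : ℝ) + 1) / 2 * C + 1) < (k : ℝ) * (((l : ℝ) - 3) * ((l : ℝ) + 1)) := by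
  refine criterion_of_le_of_lt h11 hC0 ?_
  have : (24 : ℝ) ≤ k := by exact_mod_cast hk
  linarith

/-- `C ≤ 93/10` (`b ≤ 8`, the `l ≤ 125` regime of §6 (1)): `k ≥ 27` satisfies the uniform criterion
(`(11/4)·9.3 + 11/24 = 26.03… < 27`). [folklore] -/
theorem criterion_of_le_93_10 {C : ℝ} {k l : ℕ} (h11 : 11 ≤ l) (hC0 : 0 ≤ C) (hC : C ≤ 93 / 10) (hk : 27 ≤ k) :
    4 * (l : ℝ) * (((l : ℝ) + 1) / 2 * C + 1) < (k : ℝ) * (((l : ℝ) - 3) * ((l : ℝ) + 1)) := by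
  refine criterion_of_le_of_lt h11 hC0 ?_
  have : (27 : ℝ) ≤ k := by exact_mod_cast hk
  linarith

/-- Per-`l` sharp values at `C ≤ 83/10`: `k₂(11) = 24` — `4·11·(6·C + 1) ≤ 44·50.8 = 2235.2 < 24·8·12 = 2304`.
[folklore] -/
theorem criterion_eleven {C : ℝ} {k : ℕ} (hC : C ≤ 83 / 10) (hk : 24 ≤ k) :
    4 * ((11 : ℕ) : ℝ) * ((((11 : ℕ) : ℝ) + 1) / 2 * C + 1) <
      (k : ℝ) * ((((11 : ℕ) : ℝ) - 3) * (((11 : ℕ) : ℝ) + 1)) := by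
  have : (24 : ℝ) ≤ k := by exact_mod_cast hk
  push_cast
  nlinarith

/-- `k₂(13) = 22` at `C ≤ 83/10`: `4·13·(7·C + 1) ≤ 3073.2 < 22·10·14 = 3080`. [folklore] -/
theorem criterion_thirteen {C : ℝ} {k : ℕ} (hC : C ≤ 83 / 10) (hk : 22 ≤ k) :
    4 * ((13 : ℕ) : ℝ) * ((((13 : ℕ) : ℝ) + 1) / 2 * C + 1) <
      (k : ℝ) * ((((13 : ℕ) : ℝ) - 3) * (((13 : ℕ) : ℝ) + 1)) := by
  have : (22 : ℝ) ≤ k := by exact_mod_cast hk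
  push_cast
  nlinarith

/-- `k₂(17) = 21` at `C ≤ 83/10`: `4·17·(9·C + 1) ≤ 5147.6 < 21·14·18 = 5292`. [folklore] -/
theorem criterion_seventeen {C : ℝ} {k : ℕ} (hC : C ≤ 83 / 10) (hk : 21 ≤ k) :
    4 * ((17 : ℕ) : ℝ) * ((((17 : ℕ) : ℝ) + 1) / 2 * C + 1) <
      (k : ℝ) * ((((17 : ℕ) : ℝ) - 3) * (((17 : ℕ) : ℝ) + 1)) := by
  have : (21 : ℝ) ≤ k := by exact_mod_cast hk
  push_cast
  nlinarith

/-- `k₂(19) = 20` at `C ≤ 83/10`: `4·19·(10·C + 1) ≤ 6384 < 20·16·20 = 6400`. [folklore] -/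
theorem criterion_nineteen {C : ℝ} {k : ℕ} (hC : C ≤ 83 / 10) (hk : 20 ≤ k) :
    4 * ((19 : ℕ) : ℝ) * ((((19 : ℕ) : ℝ) + 1) / 2 * C + 1) <
      (k : ℝ) * ((((19 : ℕ) : ℝ) - 3) * (((19 : ℕ) : ℝ) + 1)) := by
  have : (20 : ℝ) ≤ k := by exact_mod_cast hk
  push_cast
  nlinarith

/-- `k₂(23) = 20` at `C ≤ 83/10`: `4·23·(12·C + 1) ≤ 9255.2 < 20·20·24 = 9600`. [folklore] -/
theorem criterion_twentythree {C : ℝ} {k : ℕ} (hC : C ≤ 83 / 10) (hk : 20 ≤ k) :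
    4 * ((23 : ℕ) : ℝ) * ((((23 : ℕ) : ℝ) + 1) / 2 * C + 1) <
      (k : ℝ) * ((((23 : ℕ) : ℝ) - 3) * (((23 : ℕ) : ℝ) + 1)) := by
  have : (20 : ℝ) ≤ k := by exact_mod_cast hk
  push_cast
  nlinarith

/-! ## 6. Packaged top-label forms at the table constants (the shape the HEX assembly consumes) -/

/-- **HEX-SHARP core at `C ≤ 83/10`:** for a real base `1 < p`, every odd `l ≥ 11`, every `k ≥ 24`, every real
`S ≤ C` with `0 ≤ C ≤ 83/10` and every `0 ≤ τ ≤ p^{−k/l}`: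
`p ^ ((((l−1)/2 − 1 : ℕ) + 2)·S + 1) · τ ^ (((l−1)/2)² − 1) < 1`. [folklore] -/
theorem core_ineq_dab_83_10 {p C S τ : ℝ} {k l : ℕ} (hp : 1 < p) (h11 : 11 ≤ l) (hodd : l % 2 = 1)
    (hC0 : 0 ≤ C) (hC : C ≤ 83 / 10) (hk : 24 ≤ k)
    (hS : S ≤ C) (hτ0 : 0 ≤ τ) (hτ : τ ≤ p ^ (-((k : ℝ) / l))) :
    p ^ (((((l - 1) / 2 - 1 : ℕ) : ℝ) + 2) * S + 1) * τ ^ (((l - 1) / 2) ^ 2 - 1) < 1 :=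
  core_ineq_dab hp (by omega) hodd (criterion_of_le_83_10 h11 hC0 hC hk) hS hτ0 hτ

/-- **HEX-SHARP core at `C ≤ 93/10`:** as `core_ineq_dab_83_10` with `k ≥ 27`. [folklore] -/
theorem core_ineq_dab_93_10 {p C S τ : ℝ} {k l : ℕ} (hp : 1 < p) (h11 : 11 ≤ l) (hodd : l % 2 = 1)
    (hC0 : 0 ≤ C) (hC : C ≤ 93 / 10) (hk : 27 ≤ k)
    (hS : S ≤ C) (hτ0 : 0 ≤ τ) (hτ : τ ≤ p ^ (-((k : ℝ) / l))) :
    p ^ (((((l - 1) / 2 - 1 : ℕ) : ℝ) + 2) * S + 1) * τ ^ (((l - 1) / 2) ^ 2 - 1) < 1 :=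
  core_ineq_dab hp (by omega) hodd (criterion_of_le_93_10 h11 hC0 hC hk) hS hτ0 hτ

end Summit.ABC.IUTFork.Conditional.Hex

end
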